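import Summits.HubbardSuperconductivity.HubbardSuperconductivity.Theses.ParityGapRigidity
import Literature.MathematicalPhysics.QuantumLattice.FreeFermionSectorGroundStates
import Literature.MathematicalPhysics.QuantumLattice.HubbardRingPerronFrobeniusProofs
import HarnessLib

/-!
# Route `ParityGapRigidity` — the `U = 0` calibration of the staircase clause (H4)

Companion of `Theorems/ParityGapRigidityZeroCouplingParityGap.lean` (the parity-gap clause (PG) of the
crux `GappedWindow`, stmt-HubbardSuperconductivity-2196, FAILS for the free torus at every doping).  Of the
five clauses of `GappedWindow` two are energies-only and decidable at the free point `U = 0`; this file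
settles the second one, (H4) `E(N_L ± 2) - ½[E(N_L) + E(N_L ± 4)] ≤ C/L²`, in the opposite direction:
it HOLDS for `hubbardTorus 2 L 1 0` with `C = 0` at every even `L ≥ L₀` and every `δ ∈ (0, 1/2)`.

* `exists_fermiSet_erase` — erasing a top level from a Fermi set leaves a Fermi set (abstract levels);
* `groundEnergy_free_two_mul_card_eq` — the exact free ground energy of the even sectors,
  `E⁰(2|F|) = 2 Σ_F ε_L` for every Fermi set `F` (`SU(2)`: `groundEnergyAt_eq_minEnergyOn_szSector`,
  and the free floor `minEnergyOn_szSector_free_eq`), `L ≥ 3`;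
* `staircase_free_le_zero` — nested Fermi sets `F₀ ⊂ ⋯ ⊂ F₄` of `m-2, …, m+2` levels make
  `m ↦ E⁰(2m)` convex: both (H4) curvatures at `2m` are `≤ 0` (`2 ≤ m`, `m + 2 ≤ L²`);
* `gappedWindow_staircase_clause_holds_at_zero_coupling` — the fourth conjunct of
  `Theses.ParityGapRigidity.GappedWindow` with the hypothesis `0 < U` replaced by `U = 0`, verbatim
  otherwise, is a theorem (`C = 0`, `L₀ = max 3 ⌈4/(1-δ)⌉`).

Reading (with the companion file): at the free point the crux's energies-only clauses split — (PG) false,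
(H4) true — so (H4) carries no free-fermion obstruction and the parity-gap map is the refuter instrument
that separates a would-be window from the free gas; (H3) (finitely many sector levels below `E₀ + c/L`)
is expected to fail at `U = 0` as well (gapless particle–hole continuum) but is not treated here.

Sources: J. Bardeen, L. N. Cooper, J. R. Schrieffer, Phys. Rev. 108 (1957) 1175 §II (Fermi seas);
E. H. Lieb, PRL 62 (1989) 1201 (the `S^z = 0` sector carries the ground energy).  Folklore
finite-dimensional statements; no definitions, no named facts.

## Mathlib / tree search

Tree (REUSED): `exists_fermiSet` (`FreeFermionSectorEnergyDeviation`), `minEnergyOn_szSector_free_eq`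
(`FreeFermionSectorGroundStates`), `groundEnergyAt_eq_minEnergyOn_szSector`
(`HubbardRingPerronFrobeniusProofs`).  Mathlib: `Finset.exists_max_image`, `Finset.sum_erase_add`,
`Finset.card_erase_of_mem`.
-/

-- the mandated namespace `Summit.<Summit>.<Problem>.Theorems` repeats `HubbardSuperconductivity`
-- (single-problem summit, D-0017), which the `dupNamespace` linter flags on every declaration
set_option linter.dupNamespace false

noncomputable section

namespace Summit.HubbardSuperconductivity.HubbardSuperconductivity.Theorems.ParityGapRigidityFree

open Matrix Finset Literature.MathematicalPhysics.QuantumLattice Literature.Probability.LatticeModels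


section Staircase

variable {L : ℕ} [NeZero L]

/-- **Erasing a top level from a Fermi set leaves a Fermi set.** For levels `ε`, a nonempty Fermi set
`F` (`ε ≤ e_F` on `F`, `e_F ≤ ε` off `F`) has a maximiser `a ∈ F`, and `F \ {a}` is a Fermi set with
Fermi level `ε a`; moreover `Σ_F ε = Σ_{F∖{a}} ε + ε a`. [folklore] -/
theorem exists_fermiSet_erase {ι : Type*} [DecidableEq ι] (ε : ι → ℝ) {F : Finset ι} {eF : ℝ}
    (hF : ∀ k ∈ F, ε k ≤ eF) (hF' : ∀ k ∉ F, eF ≤ ε k) (hne : F.Nonempty) :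
    ∃ a ∈ F, (∀ k ∈ F.erase a, ε k ≤ ε a) ∧ (∀ k ∉ F.erase a, ε a ≤ ε k) ∧ (∀ k ∈ F, ε k ≤ ε a) ∧
      ∑ k ∈ F, ε k = ∑ k ∈ F.erase a, ε k + ε a := by
  obtain ⟨a, haF, hmax⟩ := F.exists_max_image ε hne
  refine ⟨a, haF, fun k hk => hmax k (mem_of_mem_erase hk), fun k hk => ?_, hmax, ?_⟩
  · by_cases hka : k = a
    · rw [hka]
    · have hkF : k ∉ F := fun h => hk (mem_erase.2 ⟨hka, h⟩)
      exact (hF a haF).trans (hF' k hkF)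
  · rw [Finset.sum_erase_add F _ haF]

/-- **Exact free ground energy of the even sectors** (`L ≥ 3`): for a Fermi set `F` of band levels,
`E⁰(2|F|) = 2 Σ_F ε_L` for `hubbardTorus 2 L 1 0` — the `N`-particle ground energy over all spins is the
`(N, S^z = 0)` floor by `SU(2)` (`groundEnergyAt_eq_minEnergyOn_szSector`), which is the doubled Fermi
sum (`minEnergyOn_szSector_free_eq`). Bardeen–Cooper–Schrieffer (1957) §II; Lieb (1989). [folklore] -/
theorem groundEnergy_free_two_mul_card_eq (hL : 3 ≤ L) (F : Finset (TorusSite 2 L)) (eF : ℝ)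
    (hF : ∀ k ∈ F, torusBand L k ≤ eF) (hF' : ∀ k ∉ F, eF ≤ torusBand L k) :
    groundEnergy (hubbardTorus 2 L 1 0) (2 * F.card) = 2 * ∑ k ∈ F, torusBand L k := by
  classical
  have hcard : F.card ≤ Fintype.card (FermionTorus 2 L) := by
    calc F.card ≤ Fintype.card (TorusSite 2 L) := F.card_le_univ
      _ = L ^ 2 := by simp [TorusSite, ZMod.card, Fintype.card_fin]
      _ = Fintype.card (FermionTorus 2 L) := by simp [FermionTorus, Fintype.card_fin]
  have h := groundEnergyAt_eq_minEnergyOn_szSector (fermionTorusGraph 2 L) 1 0 hcard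
  rw [groundEnergyAt] at h
  change groundEnergy (hubbardTorus 2 L 1 0) (2 * F.card) =
    (hubbardTorus 2 L 1 0).minEnergyOn (szSector (Λ := FermionTorus 2 L) (2 * F.card) 0) at h
  rw [h, minEnergyOn_szSector_free_eq hL F eF hF hF']

/-- **The free even-step staircase is concave-free: both (H4) curvatures are `≤ 0`.** For `L ≥ 3` and
`2 ≤ m`, `m + 2 ≤ L²`, with `E = groundEnergy (hubbardTorus 2 L 1 0)`:
`E(2m+2) - ½[E(2m) + E(2m+4)] ≤ 0` and `E(2m-2) - ½[E(2m) + E(2m-4)] ≤ 0`.  Proof: nested Fermi sets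
`F₀ ⊂ F₁ ⊂ F₂ ⊂ F₃ ⊂ F₄` of `m-2, …, m+2` levels (erase a top level four times,
`exists_fermiSet_erase`) give `E(2|F_i|) = 2 Σ_{F_i} ε_L` (`groundEnergy_free_two_mul_card_eq`) with
increments `2 ε(a_{i+1})`, `ε(a₁) ≤ ε(a₂) ≤ ε(a₃) ≤ ε(a₄)`; the two curvatures are `ε(a₃) - ε(a₄)` and
`ε(a₁) - ε(a₂)`. [folklore] -/
theorem staircase_free_le_zero (hL : 3 ≤ L) {m : ℕ} (hm2 : 2 ≤ m) (hmL : m + 2 ≤ L ^ 2) :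
    groundEnergy (hubbardTorus 2 L 1 0) (2 * m + 2) -
          (groundEnergy (hubbardTorus 2 L 1 0) (2 * m) + groundEnergy (hubbardTorus 2 L 1 0) (2 * m + 4)) / 2 ≤ 0 ∧
      groundEnergy (hubbardTorus 2 L 1 0) (2 * m - 2) -
          (groundEnergy (hubbardTorus 2 L 1 0) (2 * m) + groundEnergy (hubbardTorus 2 L 1 0) (2 * m - 4)) / 2 ≤ 0 := by
  classical
  -- a Fermi set of `m + 2` levels and four successive erasures of a top level
  have hcard : m + 2 ≤ Fintype.card (TorusSite 2 L) := by
    have : Fintype.card (TorusSite 2 L) = L ^ 2 := by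
      simp [TorusSite, ZMod.card, Fintype.card_fin]
    omega
  obtain ⟨F₄, e₄, hF₄c, hF₄, hF₄'⟩ := exists_fermiSet (torusBand L) hcard
  obtain ⟨a₄, ha₄, hF₃, hF₃', hmax₄, hS₄⟩ :=
    exists_fermiSet_erase (torusBand L) hF₄ hF₄' (card_pos.1 (by omega))
  have hF₃c : (F₄.erase a₄).card = m + 1 := by rw [card_erase_of_mem ha₄, hF₄c]; rfl
  obtain ⟨a₃, ha₃, hF₂, hF₂', hmax₃, hS₃⟩ :=
    exists_fermiSet_erase (torusBand L) hF₃ hF₃' (card_pos.1 (by omega))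
  have hF₂c : ((F₄.erase a₄).erase a₃).card = m := by rw [card_erase_of_mem ha₃, hF₃c]; rfl
  obtain ⟨a₂, ha₂, hF₁, hF₁', hmax₂, hS₂⟩ :=
    exists_fermiSet_erase (torusBand L) hF₂ hF₂' (card_pos.1 (by omega))
  have hF₁c : (((F₄.erase a₄).erase a₃).erase a₂).card = m - 1 := by rw [card_erase_of_mem ha₂, hF₂c]
  obtain ⟨a₁, ha₁, hF₀, hF₀', hmax₁, hS₁⟩ :=
    exists_fermiSet_erase (torusBand L) hF₁ hF₁' (card_pos.1 (by omega))
  have hF₀c : ((((F₄.erase a₄).erase a₃).erase a₂).erase a₁).card = m - 2 := by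
    rw [card_erase_of_mem ha₁, hF₁c]; omega
  -- monotonicity of the erased levels
  have h34 : torusBand L a₃ ≤ torusBand L a₄ := hmax₄ a₃ (mem_of_mem_erase ha₃)
  have h12 : torusBand L a₁ ≤ torusBand L a₂ := hmax₂ a₁ (mem_of_mem_erase ha₁)
  -- the five even-sector energies
  have hE₄ := groundEnergy_free_two_mul_card_eq hL F₄ e₄ hF₄ hF₄'
  have hE₃ := groundEnergy_free_two_mul_card_eq hL _ _ hF₃ hF₃'
  have hE₂ := groundEnergy_free_two_mul_card_eq hL _ _ hF₂ hF₂'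
  have hE₁ := groundEnergy_free_two_mul_card_eq hL _ _ hF₁ hF₁'
  have hE₀ := groundEnergy_free_two_mul_card_eq hL _ _ hF₀ hF₀'
  rw [hF₄c, show 2 * (m + 2) = 2 * m + 4 by ring] at hE₄
  rw [hF₃c, show 2 * (m + 1) = 2 * m + 2 by ring] at hE₃
  rw [hF₂c] at hE₂
  rw [hF₁c, show 2 * (m - 1) = 2 * m - 2 by omega] at hE₁
  rw [hF₀c, show 2 * (m - 2) = 2 * m - 4 by omega] at hE₀
  rw [hE₄, hE₃, hE₂, hE₁, hE₀, hS₄, hS₃, hS₂, hS₁]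
  constructor <;> linarith

end Staircase

/-- **`U = 0` calibration of the staircase clause (H4) of `GappedWindow`: it HOLDS at zero coupling**,
with `C = 0`, at every even `L ≥ L₀` and every `δ ∈ (0, 1/2)` — the fourth conjunct of
`Theses.ParityGapRigidity.GappedWindow` with the hypothesis `0 < U` replaced by `U = 0`, verbatim
otherwise (`staircase_free_le_zero` at `m = ⌊(1-δ)L²/2⌋ ≥ 2`).  Together with
`gappedWindow_parityGap_clause_fails_at_zero_coupling`: of the two energies-only clauses of the crux the
free gas fails (PG) and passes (H4). [folklore] -/
theorem gappedWindow_staircase_clause_holds_at_zero_coupling :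
    ∀ (U δ : ℝ), U = 0 → δ ∈ Set.Ioo (0 : ℝ) (1 / 2) →
      (∃ C : ℝ, ∃ L₀ : ℕ, ∀ L ≥ L₀, Even L → ∀ Hm, Hm = Literature.MathematicalPhysics.QuantumLattice.hubbardTorus 2 L 1 U → ∀ (E : ℕ → ℝ) (n : ℕ), E = Literature.MathematicalPhysics.QuantumLattice.groundEnergy Hm → n = 2 * ⌊(1 - δ) * (L : ℝ) ^ 2 / 2⌋₊ → E (n + 2) - (E n + E (n + 4)) / 2 ≤ C / (L : ℝ) ^ 2 ∧ E (n - 2) - (E n + E (n - 4)) / 2 ≤ C / (L : ℝ) ^ 2) := by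
  rintro U δ rfl hδ
  have hx : 0 < 1 - δ := by linarith [hδ.2]
  refine ⟨0, max 3 ⌈4 / (1 - δ)⌉₊, fun L hL _ Hm hHm E n hE hn => ?_⟩
  have hL3 : 3 ≤ L := le_trans (le_max_left _ _) hL
  have hLc : ⌈4 / (1 - δ)⌉₊ ≤ L := le_trans (le_max_right _ _) hL
  haveI : NeZero L := ⟨by omega⟩
  set m : ℕ := ⌊(1 - δ) * (L : ℝ) ^ 2 / 2⌋₊ with hm
  have hLr : (4 / (1 - δ) : ℝ) ≤ L := le_trans (Nat.le_ceil _) (by exact_mod_cast hLc)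
  have hL1 : (1 : ℝ) ≤ L := by exact_mod_cast (show 1 ≤ L by omega)
  have hm2 : 2 ≤ m := by
    refine Nat.le_floor ?_
    have h4 : 4 ≤ (1 - δ) * L := by
      rw [div_le_iff₀ hx] at hLr; linarith
    have : (1 - δ) * L ≤ (1 - δ) * (L : ℝ) ^ 2 := by
      rw [sq]; exact mul_le_mul_of_nonneg_left (le_mul_of_one_le_left (by positivity) hL1) hx.le
    push_cast
    linarith
  have hmL : m + 2 ≤ L ^ 2 := by
    have h1 : (m : ℝ) ≤ (1 - δ) * (L : ℝ) ^ 2 / 2 := Nat.floor_le (by positivity)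
    have hL2 : (9 : ℝ) ≤ (L : ℝ) ^ 2 := by
      have : (3 : ℝ) ≤ L := by exact_mod_cast hL3
      nlinarith
    have h3 : (m : ℝ) + 2 ≤ (L : ℝ) ^ 2 := by nlinarith [hδ.1]
    exact_mod_cast h3
  obtain ⟨hup, hdown⟩ := staircase_free_le_zero hL3 hm2 hmL
  subst hE hHm
  rw [hn, zero_div]
  exact ⟨hup, hdown⟩

end Summit.HubbardSuperconductivity.HubbardSuperconductivity.Theorems.ParityGapRigidityFree

end
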